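import Literature.MathematicalPhysics.QuantumFieldTheory.Balaban1983to89.B9KnitMajorantsOfCubeData
import Literature.MathematicalPhysics.QuantumFieldTheory.Balaban1983to89.B8Thm2TorusLettersTauOfKnit
import Literature.MathematicalPhysics.QuantumFieldTheory.Balaban1983to89.B8Thm2SetupTorusOfCubes

/-!
# `Balaban1983to89.B8Thm2TorusKnitOfCubeData` — [B8] THM 2 ON `T_η` FOR `SU(N)`, ITS LANDAU-GAUGE LETTERS BEING [B9]'s OPERATORS AT PRINT's TRANSPORTERS, FROM THE
# PER-CUBE (3.35) DATA ALONE: the G-B8-T2S torus endpoint `thm2TorusAt_specialUnitary_ofMajorants_tr` (seat t2s-1, file A5) COMPOSED with seat p33's FILE 15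
# `B9KnitMajorantsOfCubeData.knitMajorants_of_cubeData_unitary` — the [B9] Thm 3.1 (3.42)₁,₂ ∕ Thm 3.2 (3.48) block majorants at print's knit letter being
# THEOREMS there (FILES 12 ∕ 13 ∕ 14, Theorem D included), what stays displayed per member and background is ONLY the family of per-cube (3.35) data; the member
# catalogue (with its «M sufficiently large» ∕ «RM satisfying (2.59)» thresholds) and the (B)-lines stay displayed as on the whole route (FILE 16 of seat p33)

statement-level skeleton of published theorems with citation tags; proofs where landed; nothing here is a claim about the
Yang–Mills mass gap

T. Bałaban, *Spaces of regular gauge field configurations on a lattice and gauge fixing conditions*, Commun. Math. Phys. **99** (1985) 75–102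
[`Balaban1985RegularSpaces`, "[B8]"]: Thm 2 p. 83 (*«we can take β₀, α₁ arbitrary positive numbers and then there exists B₁ such that the above theorem holds»*),
Thm 4 p. 88, (1.7) p. 77, p. 77 (*«Ω_j = T_η for j = 0,1,…,l»*), p. 76 (*«G = SU(N)»*), (1.91)–(1.98) pp. 91–92, (1.101) p. 93, Prop. 3 (1.59) p. 86, (1.33)–(1.39)
pp. 82–83.  T. Bałaban, *Propagators for lattice gauge theories in a background field*, Commun. Math. Phys. **99** (1985) 389–434 [`Balaban1985BackgroundPropagators`,
"[B9]"]: Thm 3.1 (3.42) p. 397 (*«for M ≥ M₁»*), Thm 3.2 (3.48) p. 398, (3.35)–(3.37) p. 396, (3.19)–(3.25) pp. 393–395, Cor. 3.6 p. 408, Thm 3.7 pp. 409–410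
(*«for M sufficiently large»*), Thm 3.9 p. 413 (*«This theorem implies Theorem 3.2»*), p. 412 l. 1–9 (Theorem D), Thm 3.11 p. 416.  [4] = T. Bałaban, *Propagators
and renormalization transformations for lattice gauge theories. II*, Commun. Math. Phys. **96** (1984) 223–250 [`Balaban1984PropagatorsII`]: (2.1)–(2.4) p. 224,
(2.50)–(2.54) pp. 232–233, Lemma 2.1 (2.59)–(2.63) pp. 233–234.  T. Bałaban, *Averaging operations for lattice gauge theories*, Commun. Math. Phys. **98** (1985)
17–51 [`Balaban1985Averaging`, "[B7]"]: (4) p. 18, Prop. 2 p. 26, (52)–(53) pp. 26–27.  [2] = T. Bałaban, *Regularity and decay of lattice Green's functions*,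
Commun. Math. Phys. **89** (1983) 571–597 [`Balaban1983RegularityDecay`]: Thm (5.8) p. 594.  STATUS: published, refereed.

THE PRINT.  [B8] p. 91–92: the operators `G′(U)`, `(Q′G′²Q′*)⁻¹(U)`, `H′(U)` of the Landau-gauge construction and their bounds (1.101) ∕ (1.98) *«proved in [15]»*
(= [B9] Thms 3.1–3.2); [B9] p. 410 *«Theorem 3.1 follows simply from Corollary 3.6 holding for all G′_□, □ ∈ 𝒟, from the bound (3.89) and Lemma 2.1»*, p. 413
*«This theorem implies Theorem 3.2»*; the per-cube datum is (3.35)–(3.37) p. 396: on (a neighbourhood of) every cube `□` the background is a small field,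
`U = (exp iηA_□)^{u_□}` with `|A_□| ≤ α₁(□)ξ(□)⁻¹`, `|∇^η A_□| ≤ α₁(□)ξ(□)⁻²`, `α₁(□)` sufficiently small.

WHY THIS FILE ∕ THE ARGUMENT.  Seat t2s-1's file A5 `B8Thm2TorusLettersTauOfKnit.thm2TorusAt_specialUnitary_ofMajorants_tr` proves `Thm2TorusAt (ℓ+1) k P η 0 B₁
B₂ c₁ len SU(N) ⊤` from (i) a member catalogue, (ii) per member `n ≤ k` and background `U₀ ∈ 𝔄_n(T_η, α₀)` the block-majorant package `KnitMajorants` with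
uniform `KnitConstants`, (iii) the (B)-lines.  Seat p33's FILE 15 `B9KnitMajorantsOfCubeData.knitMajorants_of_cubeData_unitary` INHABITS (ii) for every member
above one threshold and every `U(N)`-valued background of the class (52) carrying per-cube (3.35) data, for every resummation triple `(δ₀, βₓ, ρ)`.  This file
composes the two: the resummation triple is chosen `(δ∕4, 1, δ∕2)` (so the budget `ρ + 2βₓδ₀ ≤ δ` of `KnitConstants` is an identity), the five internal windows
`B_G, B₀′ᴴ, B₂′, B_R, B₀′` are chosen by file A9's `max … 0 ∕ 1` pattern at `(A, A₁, K, d₁, c) := (K_G, K_D, K_C, exp261 geo9K δ₀ βₓ, c₁(exp261 geo9K ρ 1, ρ, 1))`,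
the class size is `a₀′ := min(a₀, 1∕(3C₀), c₂′∕2)` (FILE 15's `a₀` capped by [B7] Prop. 2's thresholds), the flatness `pdev (liftCfg (bgY i U₀)) < a₀′L^{−2k}` at the
member's finest scale comes from the consumer's class (1.7) by file A9's `pdev_liftCfg_bgY_lt_of_inAk` under the catalogue's level slack `k ≤ n + e_s` with
`c_L·L^{2e_s} < a₀′` (`thresholds_of_slack` transfers the Prop. 2 thresholds to `c_L`), `G = SU(N) ≤ U(N)` is averaging-closed for `N ≤ 25`
(`avgClosed_specialUnitary_of_le`), and FILE 15's background-family bookkeeping binder `{B : B9.Backgrounds} cfg U₁` is inhabited by the one-point family.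

CITATION HEADER (lean-in-tree rule).  Cell `lit-balaban`, seat `lit-balaban-p33` gen 100, 2026-08-28, FILE 16 (the OFFER (i) of gen 99's HANDOFF); sub-rows
G-B9-LETTERS × G-B8-T2S (R3 `stmt-QuantumFields-19200`, helper).  CONSUMED BY NAME: p33 FILE 15 `knitMajorants_of_cubeData_unitary` (p654054); t2s-1 A5
`thm2TorusAt_specialUnitary_ofMajorants_tr`, A9 `pdev_liftCfg_bgY_lt_of_inAk`, `thresholds_of_slack`, A2 `bgY`, `bgY_mem`, `shiftCfg_U₀`, A4 `KnitConstants`,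
`B9P3PerAt`; `B8Thm2SetupTorus.thm2SetupSUAt_of_thm2TorusAt`, `pow_dvd_period`; `B7Prop2SpecialUnitary.specialUnitaryUnits_le_unitaryUnits`,
`B7AvgClosedSpecialUnitarySharp.avgClosed_specialUnitary_of_le`, `B7Prop2Explicit.C0_pos`, `c2'_pos`, `B6RandomWalk.c1_nonneg`.

WHAT THIS FILE PROVES (sorry-free; no definitions; nothing of [B8]'s own estimates asserted).
* §1 ★★★★ **`thm2TorusAt_specialUnitary_ofCubeData`** — for `1 ≤ N ≤ 25`, `d + 1 ≥ 2`, `ℓ ≥ 1`, the (B)-line constants `B₀` (`2 ≤ 5(d+1)LB₀`), `B₀β`, `c_B9 > 0`,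
  `β`, `len`, a `B₁` above print's margin `5(d+1)LB₀(1 + 11(d+1)²)`, a real basis `b` of `M_N(ℂ)` with coordinate bound `M₂`, scalar walk data `Rr, Hp`, a level
  slack `e_s`, a member catalogue `memF k P n` with sections `ιBF`: `∃ a₁ > 0` (the (3.37) size), `∃ a₀′ > 0` (the class size), `∃ M₀ T₀ N₀` (member thresholds) such
  that for every `c_L > 0` with `c_L·L^{2e_s} < a₀′` there are `B₂, c₁ > 0` such that for every `k ≥ 1`, `η > 0`, `P ∈ Lᵏℤ`: catalogue clauses (period `P`,
  constant level `n`, `M₀ ≤ L·M_h`, `N₀ + 1 ≤ R·M`, `T₀ ≤ R·M − 1`, `c_f = Lᵏ`, nominal index `≤ n + e_s`, `ιBF` a section of `β`) → [for every member `n ≤ k`, every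
  `α₀ ≤ c_L` and every `SU(N)`-valued `P`-periodic `U₀ ∈ 𝔄_n(T_η, α₀)`: a FAMILY OF PER-CUBE (3.35) DATA for `bgY (memF k P n) U₀` — bi-contractive gauges `u_□`,
  potentials `A_□` on torus sets `Q_□ ⊇ NearC_□(35S_j∕8 + 1)`, sizes `C(□), ξ(□), Λ(□)` with the nine (3.35) clauses and the (3.37) sizes `≤ a₁`, `≤ ¼`
  (FILES 12–15's unpacked form verbatim)] → (B)-lines `B9P3PerAt` → `Thm2TorusAt (ℓ+1) k P η 0 B₁ B₂ c₁ len SU(N) ⊤`.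
* §2 ★★★★ **`thm2SetupSUAt_ofCubeData_exists`** — the Setup-torus form read by the 19200 dictionary: the same header, then `∃ B₁ B₂ c₁ > 0` (namely
  `B₁ = 5(d+1)LB₀(1 + 11(d+1)²) + 1`) such that for every `m K k η` (`1 ≤ k ≤ m + K`, `η > 0`), at `P₀ = sitesPerDir 0` of `PV d ℓ m K`: catalogue → per-cube
  (3.35) data → (B)-lines → `Thm2SetupSUAt (PV d ℓ m K hd hL) N k η 0 B₁ B₂ c₁ len (fun _ => True)`.

HONEST SCOPE ∕ NOT CLAIMED.  Composition of landed theorems with threshold ∕ window bookkeeping; NO estimate of [B8] ∕ [B9] ∕ [4] is proved IN THIS FILE (the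
[B9] Thm 3.1 ∕ 3.2 majorants are theorems of FILES 12–14 upstream; the (B)-lines (Prop. 3's in-edge (1.59)) are DISPLAYED; the per-cube (3.35) data family for the
member's reading `bgY i U₀` of a class background is DISPLAYED — which class cube supplies it from `U₀ ∈ 𝔄_n(T_η, α₀)` is FILE 4's open question (Q1) ∕ seat
p38's smallness bridge, NOT answered here; the member catalogue with its thresholds `M₀ ≤ L·M_h` ([B9] «M sufficiently large»), `N₀ + 1 ≤ R·M`, `T₀ ≤ R·M − 1`
([4] «for RM satisfying (2.59)»), `c_f = Lᵏ`, nominal index `≤ n + e_s`, section `ιB` is DISPLAYED — t2s-1's A11 constructs catalogues for the `M`-threshold only;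
an `R`-threshold catalogue is NOT constructed here).  DESIGN constants (not printed constants): `(δ₀, βₓ, ρ) = (δ∕4, 1, δ∕2)`, the windows, `a₀′`, `B₁`'s `+1`.
Sup-entries only; finite `𝕋` members of the k-level V1 family; `SU(N)`, `N ≤ 25` (the tree's averaging-closure range); count-neutral; no summit ∕ sub-problem
statement is proved; nothing continuum ∕ OS ∕ mass-gap ∕ Clay; NOT a node discharge; `stub_PV3A` NOT discharged.  No `sorry`, no `axiom`, no `… : Prop` fact,
no `instance`, no `notation`, no `def`.  NEW file; nothing landed is modified.  `--supports stmt-QuantumFields-19200` as helper.  Net new unproved facts: 0.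

RELATED IN THE TREE, NOT DUPLICATED (searched 2026-08-28: `lean search 'ofCubeData|thm2SetupSUAt_ofCubeData' --decl` = ∅ — FILES 12–15's declarations are
`…_of_cubeData_…`; `lean search 'thm2TorusAt_specialUnitary_of' --decl` = 8 hits: A4 `…ofMajorants`, A5 `…ofMajorants_tr`, A9 `…ofCubes_tr`, A3 `…ofParKnitY`,
`…of_letters`, `…of_lettersPer`, `…of_lettersPerB9`, `…of_sockets` — none reads the per-cube (3.35) DATA):
t2s-1's A9 `B8Thm2SetupTorusOfCubes` (the SAME composition for A8's `KnitCubeInputs` packages — a different, hypothesis-level input list; pattern REUSED, file not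
modified), A11 ∕ A12 ∕ A14 (catalogue ∕ scalars ∕ core data for that route); p33 FILE 15 (USED).
-/

noncomputable section

open scoped BigOperators

namespace Literature.MathematicalPhysics.QuantumFieldTheory.Balaban1983to89.B8Thm2TorusKnitOfCubeData

open Node00 B6KLevelCensusIndexV1 B9Eq39Adjoint
open B7Prop1Explicit renaming Site → LSite
open B7Prop1Explicit (e)
open B7Prop2Explicit (unitaryUnits AvgClosed pdev C0 c2' C0_pos c2'_pos)
open B4PartitionUnity22 (thetaProf D1)
open B6Cover236MultiLevelBlocks (cubes)
open B6GlobalChartV1 (PV boxEquiv)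
open B6Ineq2142KLevelV1 (β)
open B6RandomWalk (c1_nonneg)
open B9BackgroundsKLevelV1 (shiftsV1)
open B9Eq360DeltaPrimeAY (AfldY)
open B9CubeGeometryInputs (RM1)
open B9GeoNormsKLevelV1 (geo9K)
open B9RWSums347DefiniteFaces (exp261)
open B9Ineq349SiteComposite (etaS_pos)
open B9Cor36CubeCutoffs (SC NearC)
open B8Ineq132 (InAk)
open B12Ineq417Flat (shiftCfg)
open B8Thm2TorusAt (Thm2TorusAt)
open B9B8CarrierDictionary (liftCfg)
open B8Thm2TorusLettersPerOfKnit (bgY bgY_mem shiftCfg_U₀)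
open B8Thm2TorusKnitEstimatesOfMajorants (KnitConstants KnitMajorants B9P3PerAt)
open B8Thm2TorusLettersTauOfKnit (thm2TorusAt_specialUnitary_ofMajorants_tr)
open B8Thm2SetupTorusOfCubes (pdev_liftCfg_bgY_lt_of_inAk thresholds_of_slack)
open B9KnitMajorantsOfCubeData (knitMajorants_of_cubeData_unitary)
open B7Prop2SpecialUnitary (specialUnitaryUnits specialUnitaryUnits_le_unitaryUnits)
open B7AvgClosedSpecialUnitarySharp (avgClosed_specialUnitary_of_le)
open B8Thm2SetupTorus (Thm2SetupSUAt thm2SetupSUAt_of_thm2TorusAt pow_dvd_period)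
open scoped Matrix Matrix.Norms.L2Operator

variable {d ℓ : ℕ} {hd : 1 ≤ d + 1} {hL : Odd (ℓ + 1) ∧ 1 < ℓ + 1} {b₀ b₁ : ℝ}

/-! ## §1 ★★★★ [B8] Thm 2 on `T_η` for `SU(N)` from the per-cube (3.35) data, the (B)-lines and the catalogue -/

section Torus

variable {N : ℕ} [NeZero N]
variable [instF : ∀ i : KIdx d ℓ hd hL b₀ b₁, Fintype (geo9K i).Site] [instD : ∀ i : KIdx d ℓ hd hL b₀ b₁, DecidableEq (geo9K i).Site]

/-- ★★★★ **[B8] THM 2 ON `T_η` FOR `SU(N)` (`N ≤ 25`), ITS LANDAU-GAUGE LETTERS BEING [B9]'s OPERATORS AT PRINT's TRANSPORTERS, FROM THE PER-CUBE (3.35) DATA**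
(t2s-1 A5 `thm2TorusAt_specialUnitary_ofMajorants_tr` ∘ p33 FILE 15 `knitMajorants_of_cubeData_unitary`).  For `d + 1 ≥ 2`, `ℓ ≥ 1`, the (B)-line constants
`B₀` (`2 ≤ 5(d+1)LB₀`), `B₀β`, `c_B9 > 0`, `β`, `len`, `B₁ > 5(d+1)LB₀(1 + 11(d+1)²)`, a real basis `b` of `M_N(ℂ)` with coordinate bound `M₂`, scalar walk data
`Rr, Hp`, a level slack `e_s` and a member catalogue `memF` with sections `ιBF`: there are `a₁ > 0` (the (3.37) size), `a₀′ > 0` (the class size) and member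
thresholds `M₀, T₀, N₀` such that for every `c_L > 0` with `c_L·L^{2e_s} < a₀′` there are `B₂, c₁ > 0` such that for every `k ≥ 1`, `η > 0`, `P ∈ Lᵏℤ` — GIVEN
(i) the catalogue clauses at `(k, P)`: period `P`, constant level `n`, `M₀ ≤ L·M_h`, `N₀ + 1 ≤ R·M`, `T₀ ≤ R·M − 1`, `c_f = Lᵏ`, nominal index `≤ n + e_s`, `ιBF` a
section; (ii) for every member `n ≤ k`, every `0 < α₀ ≤ c_L` and every `SU(N)`-valued `P`-periodic `U₀ ∈ 𝔄_n(T_η, α₀)`, a family of per-cube (3.35) data for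
`bgY (memF k P n) U₀` (bi-contractive gauges `u_□`, potentials `A_□` on torus sets `Q_□ ⊇ NearC_□(35S_j∕8 + 1)`, sizes `C, ξ, Λ`, the nine (3.35) clauses, the (3.37)
sizes `≤ a₁` and `≤ ¼`); (iii) the (B)-lines `B9P3PerAt` — `Thm2TorusAt (ℓ+1) k P η 0 B₁ B₂ c₁ len SU(N) ⊤` holds.  HONEST SCOPE: (i)–(iii) displayed, inhabited
by nothing here; the [B9] Thm 3.1∕3.2 majorants behind it are FILES 12–14's theorems; count-neutral; `stub_PV3A` NOT discharged; nothing continuum ∕ ℝ⁴ ∕ OS ∕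
mass-gap ∕ Clay — the Yang–Mills mass gap is NOT proved.
[cite: Balaban1985RegularSpaces, Thm 2 p.83, Thm 4 p.88, (1.7) p.77, p.76, p.77 («Ω_j = T_η»), (1.91)–(1.98) pp.91–92, (1.101) p.93, (1.59) p.86; Balaban1985BackgroundPropagators, Thm 3.1 (3.42) p.397, Thm 3.2 (3.48) p.398, (3.35)–(3.37) p.396, (3.19)–(3.25) pp.393–395, Cor. 3.6 p.408, Thm 3.7 pp.409–410, Thm 3.9 p.413, p.412 l.1–9, Thm 3.11 p.416; Balaban1984PropagatorsII, (2.50)–(2.54) pp.232–233, Lemma 2.1 (2.59)–(2.63) pp.233–234; Balaban1985Averaging, Prop. 2 p.26, (52)–(53) pp.26–27; Balaban1983RegularityDecay, Thm (5.8) p.594] -/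
theorem thm2TorusAt_specialUnitary_ofCubeData (hN : N ≤ 25) (hd2 : 2 ≤ d + 1) (hℓ : 1 ≤ ℓ)
    {B₀ B₀β cB9 βH B₁ : ℝ} {len : LSite (d + 1) → ℝ}
    (hB₀ : 0 < B₀) (hB : 2 ≤ 5 * ((d + 1 : ℕ) : ℝ) * ((ℓ + 1 : ℕ) : ℝ) * B₀) (hcB9 : 0 < cB9)
    (hB₁ : 5 * ((d + 1 : ℕ) : ℝ) * ((ℓ + 1 : ℕ) : ℝ) * B₀ * (1 + 11 * (((d + 1 : ℕ) : ℝ)) ^ 2) < B₁)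
    {ι : Type} [Fintype ι] [DecidableEq ι] (b : Module.Basis ι ℝ (Matrix (Fin N) (Fin N) ℂ)) {M₂ : ℝ} (hM₂ : 0 ≤ M₂)
    (hrepr : ∀ (v : Matrix (Fin N) (Fin N) ℂ) (j : ι), |b.repr v j| ≤ M₂ * ‖v‖) (Rr : ℝ) (Hp : Prop) (es : ℕ)
    (memF : ℕ → ℤ → ℕ → KIdx d ℓ hd hL b₀ b₁) (ιBF : ∀ k P n, BlkY (memF k P n) → IBondY (memF k P n)) :
    letI : CStarAlgebra (Matrix (Fin N) (Fin N) ℂ) := {}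
    ∃ a₁ : ℝ, 0 < a₁ ∧ ∃ a₀' : ℝ, 0 < a₀' ∧ ∃ M₀ T₀ : ℝ, ∃ N₀ : ℕ,
    ∀ cL : ℝ, 0 < cL → cL * (((ℓ + 1 : ℕ) : ℝ)) ^ (2 * es) < a₀' →
    ∃ B₂ c₁ : ℝ, 0 < B₂ ∧ 0 < c₁ ∧ ∀ (k : ℕ) (P : ℤ) (η : ℝ), 1 ≤ k → 0 < η → (∃ M : ℤ, P = ((ℓ + 1 : ℕ) : ℤ) ^ k * M) →
      (∀ n, 1 ≤ n → n ≤ k → (((PV d ℓ (memF k P n).m (memF k P n).K hd hL).sitesPerDir 0 : ℕ) : ℤ) = P) →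
      (∀ n, 1 ≤ n → n ≤ k → ∀ z : SiteY (memF k P n), levY (memF k P n) z = n) →
      (∀ n, 1 ≤ n → n ≤ k →
        M₀ ≤ ((ℓ : ℝ) + 1) * (toKT (memF k P n)).Mh ∧ N₀ + 1 ≤ (toKT (memF k P n)).R * ((ℓ + 1) * (toKT (memF k P n)).Mh) ∧
        T₀ ≤ RM1 (memF k P n) ∧ (memF k P n).cf = (((ℓ + 1 : ℕ) : ℝ)) ^ (memF k P n).k ∧ (memF k P n).k ≤ n + es ∧
        ∀ s, β (memF k P n).hN (memF k P n).D (memF k P n).hk (ιBF k P n s) = s) →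
      (∀ n, 1 ≤ n → n ≤ k → ∀ ⦃α₀ : ℝ⦄, 0 < α₀ → α₀ ≤ cL → ∀ U₀ : LSite (d + 1) → Fin (d + 1) → (Matrix (Fin N) (Fin N) ℂ)ˣ,
          (∀ x κ, U₀ x κ ∈ specialUnitaryUnits (Fin N)) → (∀ (x : LSite (d + 1)) (μ : Fin (d + 1)), U₀ (x + P • e μ) = U₀ x) →
          InAk (ℓ + 1) n η α₀ (fun _ => (Set.univ : Set (LSite (d + 1)))) U₀ →
          ∃ (g : ↥(cubes (toKT (memF k P n)).D.toDomains) → GaugeY (Matrix (Fin N) (Fin N) ℂ) (memF k P n))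
            (A : ↥(cubes (toKT (memF k P n)).D.toDomains) → AfldY (Matrix (Fin N) (Fin N) ℂ) (memF k P n))
            (Q : ↥(cubes (toKT (memF k P n)).D.toDomains) → Set (Site (PV d ℓ (memF k P n).m (memF k P n).K hd hL) 0))
            (C ξ Λ : ↥(cubes (toKT (memF k P n)).D.toDomains) → ℝ),
            (∀ c x, ‖(g c x : Matrix (Fin N) (Fin N) ℂ)‖ ≤ 1 ∧ ‖(((g c x)⁻¹ : (Matrix (Fin N) (Fin N) ℂ)ˣ) : Matrix (Fin N) (Fin N) ℂ)‖ ≤ 1) ∧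
            (∀ c, 0 ≤ C c) ∧ (∀ c, 0 < ξ c) ∧ (∀ c, 1 ≤ Λ c) ∧ (∀ c, ξ c ≤ 5 * (SC (memF k P n) c : ℝ) * (kGeo (memF k P n)).eta) ∧
            (∀ c, LatticeNorms.scaleLen ((ℓ : ℝ) + 1) (kGeo (memF k P n)).eta (c.1.1 + 1) ≤ Λ c * ξ c) ∧
            (∀ c, ∀ x : Site (PV d ℓ (memF k P n).m (memF k P n).K hd hL) 0,
              NearC (memF k P n) c (35 * SC (memF k P n) c / 8 + 1) (boxEquiv (memF k P n).hN x).1 → x ∈ Q c) ∧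
            (∀ c, ∀ (κ : Fin (d + 1)) (x : Site (PV d ℓ (memF k P n).m (memF k P n).K hd hL) 0), x ∈ Q c → x.shift κ ∈ Q c →
              gaugeY (memF k P n) (g c) (bgY (memF k P n) U₀) κ x = fluct (kGeo (memF k P n)).eta (A c) κ x) ∧
            (∀ c, ∀ κ, ∀ x ∈ Q c, ‖A c κ x‖ ≤ C c * (ξ c)⁻¹) ∧
            (∀ c, ∀ μ ν, ∀ x ∈ Q c,
              ‖(((kGeo (memF k P n)).eta : ℂ)⁻¹) • covD (shiftsV1 (PV d ℓ (memF k P n).m (memF k P n).K hd hL))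
                  (fun _ _ => (1 : (Matrix (Fin N) (Fin N) ℂ)ˣ)) μ (A c ν) x‖ ≤ C c * (ξ c ^ 2)⁻¹) ∧
            (∀ c, max (C c) (C c * (1 + D1 thetaProf)) * Λ c ^ 2 ≤ a₁) ∧ (∀ c, max (C c) (C c * (1 + D1 thetaProf)) * Λ c ^ 2 ≤ 1 / 4)) →
      (∀ m, m ≤ k → ∀ ⦃α₀ : ℝ⦄, 0 < α₀ → α₀ ≤ cL → ∀ U₀ : LSite (d + 1) → Fin (d + 1) → (Matrix (Fin N) (Fin N) ℂ)ˣ,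
          (∀ x κ, U₀ x κ ∈ specialUnitaryUnits (Fin N)) → (∀ (x : LSite (d + 1)) (μ : Fin (d + 1)), U₀ (x + P • e μ) = U₀ x) →
          InAk (ℓ + 1) m η α₀ (fun _ => (Set.univ : Set (LSite (d + 1)))) U₀ →
          B9P3PerAt (𝔸 := Matrix (Fin N) (Fin N) ℂ) (ℓ + 1) B₀ B₀β cB9 βH len η m α₀ P U₀) →
      Thm2TorusAt (ℓ + 1) k P η 0 B₁ B₂ c₁ len (specialUnitaryUnits (Fin N)) (fun _ => True) := by
  letI : CStarAlgebra (Matrix (Fin N) (Fin N) ℂ) := {}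
  haveI : Nonempty (Fin N) := ⟨⟨0, Nat.pos_of_ne_zero (NeZero.ne N)⟩⟩
  have hG : specialUnitaryUnits (Fin N) ≤ unitaryUnits (Matrix (Fin N) (Fin N) ℂ) := specialUnitaryUnits_le_unitaryUnits
  have hGa : AvgClosed (d + 1) (ℓ + 1) (specialUnitaryUnits (Fin N)) := avgClosed_specialUnitary_of_le hN (d + 1) (ℓ + 1)
  -- FILE 15: the `KnitMajorants` package from the per-cube data, for every resummation triple
  obtain ⟨δ, KG, KD, KC, hδ, hKG, hKD, hKC, a₁, ha₁, a₀, ha₀, H⟩ :=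
    knitMajorants_of_cubeData_unitary (hd := hd) (hL := hL) (b₀ := b₀) (b₁ := b₁) b hG hGa
      (fun _ : KIdx d ℓ hd hL b₀ b₁ => Rr) (fun _ : KIdx d ℓ hd hL b₀ b₁ => Hp) hℓ hM₂ hrepr
  -- the resummation triple `(δ₀, βₓ, ρ) := (δ∕4, 1, δ∕2)`
  have hβδ : 0 < (1 : ℝ) * (δ / 4) := by positivity
  obtain ⟨M₀, T₀, N₀, HM⟩ := H (δ / 4) 1 (δ / 2) hβδ (half_pos hδ)
  -- the class size `a₀′ := min(a₀, 1∕(3C₀), c₂′∕2)`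
  have hC0 : 0 < C0 (d + 1) := C0_pos (d + 1)
  have hc2 : 0 < c2' (d + 1) (ℓ + 1) := c2'_pos (d + 1) (ℓ + 1) (Nat.succ_le_succ (Nat.zero_le ℓ))
  set a₀' : ℝ := min a₀ (min (1 / (3 * C0 (d + 1))) (c2' (d + 1) (ℓ + 1) / 2)) with ha₀'_def
  have ha₀' : 0 < a₀' := lt_min ha₀ (lt_min (div_pos one_pos (mul_pos (by norm_num) hC0)) (half_pos hc2))
  have hα3 : C0 (d + 1) * a₀' ≤ 1 / 3 :=
    calc C0 (d + 1) * a₀' ≤ C0 (d + 1) * (1 / (3 * C0 (d + 1))) :=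
          mul_le_mul_of_nonneg_left ((min_le_right _ _).trans (min_le_left _ _)) hC0.le
      _ = 1 / 3 := by field_simp [hC0.ne']
  have hα2 : 2 * a₀' ≤ c2' (d + 1) (ℓ + 1) := by
    have h := (min_le_right a₀ _).trans (min_le_right (1 / (3 * C0 (d + 1))) (c2' (d + 1) (ℓ + 1) / 2))
    linarith
  refine ⟨a₁, ha₁, a₀', ha₀', M₀, T₀, N₀, fun cL hcL hαe => ?_⟩
  obtain ⟨hc3, hc2'⟩ := thresholds_of_slack (d := d) hcL.le hαe hα3 hα2
  -- the uniform constants: budget `ρ + 2βₓδ₀ = δ`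
  have cst : KnitConstants b M₂ (δ / 4) δ 1 (δ / 2) KG KD KC :=
    { hM₂ := hM₂, hrepr := hrepr, hA := hKG, hA₁ := hKD, hK := hKC, hρ := (half_pos hδ).le, hβ := zero_le_one,
      hδ₀ := by positivity, hr := le_of_eq (by ring) }
  -- the five internal windows (file A9's `max … 0 ∕ 1` pattern)
  set d₁ : ℕ := exp261 (geo9K (d := d) (ℓ := ℓ) (hd := hd) (hL := hL) (b₀ := b₀) (b₁ := b₁)) (δ / 4) 1 with hd₁
  set c : ℝ := B6.c1 (exp261 (geo9K (d := d) (ℓ := ℓ) (hd := hd) (hL := hL) (b₀ := b₀) (b₁ := b₁)) (δ / 2) 1) (δ / 2) 1 with hc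
  set S : ℝ := ∑ j, ‖b j‖ with hS
  set BG : ℝ := max (max (S * KG * c * M₂) (S * KD * c * M₂)) 0 with hBG_def
  set BH : ℝ := max (max (S * (((M₂ * S) * KG * KG * KC * B6.c1 d₁ (δ / 4) 1 ^ 2) * c * M₂))
    (S * (((M₂ * S) * KD * KG * KC * B6.c1 d₁ (δ / 4) 1 ^ 2) * c * M₂))) 1 with hBH_def
  set B₂' : ℝ := max (S * (((M₂ * S) * KG * KC * B6.c1 d₁ (δ / 4) 1) * c * M₂)
    + S * (((M₂ * S) * KG * KG * KC * B6.c1 d₁ (δ / 4) 1 ^ 2) * c * M₂)) 0 with hB₂'_def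
  set BR : ℝ := max (1 + S * (((M₂ * S) ^ 2 * KG * KC * KG * B6.c1 d₁ (δ / 4) 1 ^ 2) * c * M₂)) 0 with hBR_def
  set B₀' : ℝ := max (3 * (2 * ((d + 1 : ℕ) : ℝ) * (((ℓ + 1 : ℕ) : ℝ)) ^ 2) * BG * (BR + 2)) 1 with hB₀'_def
  have hBG : 0 ≤ BG := le_max_right _ _
  have hBH : 0 < BH := lt_of_lt_of_le one_pos (le_max_right _ _)
  have hB₂' : 0 ≤ B₂' := le_max_right _ _
  have hBR : 0 ≤ BR := le_max_right _ _
  have hB₀' : 0 < B₀' := lt_of_lt_of_le one_pos (le_max_right _ _)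
  have hfree : 3 * (2 * ((d + 1 : ℕ) : ℝ) * (((ℓ + 1 : ℕ) : ℝ)) ^ 2) * BG * (BR + 2) ≤ B₀' := le_max_left _ _
  have hBGe : S * KG * c * M₂ ≤ BG := (le_max_left _ _).trans (le_max_left _ _)
  have hBG₁ : S * KD * c * M₂ ≤ BG := (le_max_right _ _).trans (le_max_left _ _)
  have hBHe : S * (((M₂ * S) * KG * KG * KC * B6.c1 d₁ (δ / 4) 1 ^ 2) * c * M₂) ≤ BH := (le_max_left _ _).trans (le_max_left _ _)
  have hBH₁ : S * (((M₂ * S) * KD * KG * KC * B6.c1 d₁ (δ / 4) 1 ^ 2) * c * M₂) ≤ BH := (le_max_right _ _).trans (le_max_left _ _)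
  have hB₂e : S * (((M₂ * S) * KG * KC * B6.c1 d₁ (δ / 4) 1) * c * M₂)
      + S * (((M₂ * S) * KG * KG * KC * B6.c1 d₁ (δ / 4) 1 ^ 2) * c * M₂) ≤ B₂' := le_max_left _ _
  have hBRe : 1 + S * (((M₂ * S) ^ 2 * KG * KC * KG * B6.c1 d₁ (δ / 4) 1 ^ 2) * c * M₂) ≤ BR := le_max_left _ _
  -- file A5's endpoint at these constants
  obtain ⟨B₂, c₁, hB₂pos, hc₁, Hτ⟩ :=
    thm2TorusAt_specialUnitary_ofMajorants_tr (len := len) (B₀β := B₀β) (β := βH) hN hd2 hB₀ hB₀' hB hBH hB₂' hBG hBR hcB9 hcL hfree hB₁ hc3 hc2'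
      cst hBGe hBG₁ hBHe hBH₁ hB₂e hBRe memF ιBF Rr Hp (fun k P n => (etaS (memF k P n) ^ 2 * etaS (memF k P n) ^ 2)⁻¹)
  refine ⟨B₂, c₁, hB₂pos, hc₁, fun k P η hk hη hPk hP hlev hcat hdata hb9 => Hτ k P η hk hη hPk hP hlev ?_ hb9⟩
  intro n hn hnk α₀ hα hαc U₀ hU₀G hU₀per hA
  obtain ⟨hM, hNR, hT, hcf, hke, hι⟩ := hcat n hn hnk
  obtain ⟨g, A, Q, C, ξ, Λ, hu, hCn, hξ, hΛ, hξS, hΛξ, hQ, hgA, hAb, hdA, hα₁, hα4⟩ := hdata n hn hnk hα hαc U₀ hU₀G hU₀per hA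
  have hshift := shiftCfg_U₀ (memF k P) U₀ hP hU₀per hn hnk
  have h52 : pdev (liftCfg (bgY (memF k P n) U₀)) < a₀' * ((((ℓ + 1 : ℕ) : ℝ) ^ (memF k P n).k)⁻¹) ^ 2 :=
    pdev_liftCfg_bgY_lt_of_inAk (memF k P n) hke hshift hα.le hαc hαe hA
  exact HM a₀' ha₀' (min_le_left _ _) hα3 hα2 (memF k P n) hM hNR hT hcf (ιBF k P n) hι (bgY (memF k P n) U₀)
    (bgY_mem (memF k P n) hU₀G) h52 g hu A Q C ξ Λ hCn hξ hΛ hξS hΛξ hQ hgA hAb hdA hα₁ hα4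
    (B := ⟨PUnit, PUnit.unit, fun _ _ => PUnit.unit, fun _ _ _ => True, fun _ _ _ => True, fun _ _ _ => True, fun _ _ _ => True⟩)
    (fun _ => bgY (memF k P n) U₀) PUnit.unit rfl

end Torus

/-! ## §2 ★★★★ The Setup-torus form read by the 19200 dictionary: `∃ B₁ B₂ c₁ > 0` -/

section Setup

variable {N : ℕ} [NeZero N]
variable [instF : ∀ i : KIdx d ℓ hd hL b₀ b₁, Fintype (geo9K i).Site] [instD : ∀ i : KIdx d ℓ hd hL b₀ b₁, DecidableEq (geo9K i).Site]

/-- ★★★★ **[B8] THM 2 AT THE `SU(N)`-VALUED SETUP-TORUS OBJECTS OF EVERY `PV d ℓ m K`, FROM THE PER-CUBE (3.35) DATA, THE (B)-LINES AND THE CATALOGUE, WITH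
`B₁` DISCHARGED** (`1 ≤ N ≤ 25`, `d + 1 ≥ 2`, `ℓ ≥ 1`, `L = ℓ + 1`): §1 + `B8Thm2SetupTorus.thm2SetupSUAt_of_thm2TorusAt` (`Lᵏ ∣ P₀` by `pow_dvd_period`), at
`B₁ := 5(d+1)LB₀(1 + 11(d+1)²) + 1`.  Same existential header `∃ a₁ a₀′ M₀ T₀ N₀, ∀ c_L …`, then `∃ B₁ B₂ c₁ > 0` such that for EVERY volume `m`, number of
steps `K`, level `1 ≤ k ≤ m + K`, `η > 0` and `P = P₀ = sitesPerDir 0` of `PV d ℓ m K`: catalogue clauses at `(k, P)` → per-cube (3.35) data for every member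
`n ≤ k` and every `SU(N)`-valued `P`-periodic `U₀ ∈ 𝔄_n(T_η, α₀)`, `α₀ ≤ c_L` → (B)-lines → `Thm2SetupSUAt (PV d ℓ m K hd hL) N k η 0 B₁ B₂ c₁ len (fun _ => True)`
(the shape `Prop7SPrintThm2Dict.prop2Printed_sPrint_of_thm2SetupSUAt` reads: `β₀ = 0`, `B₁, c₁` uniform).  HONEST SCOPE: the three arrows' antecedents are
displayed and inhabited by nothing here; no estimate of [B8] is proved in this file; `stub_PV3A` NOT discharged; the Yang–Mills mass gap is NOT proved.
[cite: Balaban1985RegularSpaces, Thm 2 p.83 («there exists B₁ such that the above theorem holds»), (1.33)–(1.39) pp.82–83, p.77 («Ω_j = T_η»), p.76 («G = SU(N)»); Balaban1985BackgroundPropagators, Thm 3.1 (3.42) p.397, Thm 3.2 (3.48) p.398, (3.35)–(3.37) p.396, Thm 3.7 pp.409–410, Thm 3.9 p.413; Balaban1985Averaging, (4) p.18, Prop. 2 p.26; Balaban1984PropagatorsII, Lemma 2.1 (2.59)–(2.61) pp.233–234] -/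
theorem thm2SetupSUAt_ofCubeData_exists (hN : N ≤ 25) (hd2 : 2 ≤ d + 1) (hℓ : 1 ≤ ℓ)
    {B₀ B₀β cB9 βH : ℝ} {len : LSite (d + 1) → ℝ}
    (hB₀ : 0 < B₀) (hB : 2 ≤ 5 * ((d + 1 : ℕ) : ℝ) * ((ℓ + 1 : ℕ) : ℝ) * B₀) (hcB9 : 0 < cB9)
    {ι : Type} [Fintype ι] [DecidableEq ι] (b : Module.Basis ι ℝ (Matrix (Fin N) (Fin N) ℂ)) {M₂ : ℝ} (hM₂ : 0 ≤ M₂)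
    (hrepr : ∀ (v : Matrix (Fin N) (Fin N) ℂ) (j : ι), |b.repr v j| ≤ M₂ * ‖v‖) (Rr : ℝ) (Hp : Prop) (es : ℕ)
    (memF : ℕ → ℤ → ℕ → KIdx d ℓ hd hL b₀ b₁) (ιBF : ∀ k P n, BlkY (memF k P n) → IBondY (memF k P n)) :
    letI : CStarAlgebra (Matrix (Fin N) (Fin N) ℂ) := {}
    ∃ a₁ : ℝ, 0 < a₁ ∧ ∃ a₀' : ℝ, 0 < a₀' ∧ ∃ M₀ T₀ : ℝ, ∃ N₀ : ℕ,
    ∀ cL : ℝ, 0 < cL → cL * (((ℓ + 1 : ℕ) : ℝ)) ^ (2 * es) < a₀' →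
    ∃ B₁ B₂ c₁ : ℝ, 0 < B₁ ∧ 0 < B₂ ∧ 0 < c₁ ∧ ∀ (m K k : ℕ) (η : ℝ) (P : ℤ), 1 ≤ k → k ≤ m + K → 0 < η →
      (((PV d ℓ m K hd hL).sitesPerDir 0 : ℕ) : ℤ) = P →
      (∀ n, 1 ≤ n → n ≤ k → (((PV d ℓ (memF k P n).m (memF k P n).K hd hL).sitesPerDir 0 : ℕ) : ℤ) = P) →
      (∀ n, 1 ≤ n → n ≤ k → ∀ z : SiteY (memF k P n), levY (memF k P n) z = n) →
      (∀ n, 1 ≤ n → n ≤ k →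
        M₀ ≤ ((ℓ : ℝ) + 1) * (toKT (memF k P n)).Mh ∧ N₀ + 1 ≤ (toKT (memF k P n)).R * ((ℓ + 1) * (toKT (memF k P n)).Mh) ∧
        T₀ ≤ RM1 (memF k P n) ∧ (memF k P n).cf = (((ℓ + 1 : ℕ) : ℝ)) ^ (memF k P n).k ∧ (memF k P n).k ≤ n + es ∧
        ∀ s, β (memF k P n).hN (memF k P n).D (memF k P n).hk (ιBF k P n s) = s) →
      (∀ n, 1 ≤ n → n ≤ k → ∀ ⦃α₀ : ℝ⦄, 0 < α₀ → α₀ ≤ cL → ∀ U₀ : LSite (d + 1) → Fin (d + 1) → (Matrix (Fin N) (Fin N) ℂ)ˣ,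
          (∀ x κ, U₀ x κ ∈ specialUnitaryUnits (Fin N)) → (∀ (x : LSite (d + 1)) (μ : Fin (d + 1)), U₀ (x + P • e μ) = U₀ x) →
          InAk (ℓ + 1) n η α₀ (fun _ => (Set.univ : Set (LSite (d + 1)))) U₀ →
          ∃ (g : ↥(cubes (toKT (memF k P n)).D.toDomains) → GaugeY (Matrix (Fin N) (Fin N) ℂ) (memF k P n))
            (A : ↥(cubes (toKT (memF k P n)).D.toDomains) → AfldY (Matrix (Fin N) (Fin N) ℂ) (memF k P n))
            (Q : ↥(cubes (toKT (memF k P n)).D.toDomains) → Set (Site (PV d ℓ (memF k P n).m (memF k P n).K hd hL) 0))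
            (C ξ Λ : ↥(cubes (toKT (memF k P n)).D.toDomains) → ℝ),
            (∀ c x, ‖(g c x : Matrix (Fin N) (Fin N) ℂ)‖ ≤ 1 ∧ ‖(((g c x)⁻¹ : (Matrix (Fin N) (Fin N) ℂ)ˣ) : Matrix (Fin N) (Fin N) ℂ)‖ ≤ 1) ∧
            (∀ c, 0 ≤ C c) ∧ (∀ c, 0 < ξ c) ∧ (∀ c, 1 ≤ Λ c) ∧ (∀ c, ξ c ≤ 5 * (SC (memF k P n) c : ℝ) * (kGeo (memF k P n)).eta) ∧
            (∀ c, LatticeNorms.scaleLen ((ℓ : ℝ) + 1) (kGeo (memF k P n)).eta (c.1.1 + 1) ≤ Λ c * ξ c) ∧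
            (∀ c, ∀ x : Site (PV d ℓ (memF k P n).m (memF k P n).K hd hL) 0,
              NearC (memF k P n) c (35 * SC (memF k P n) c / 8 + 1) (boxEquiv (memF k P n).hN x).1 → x ∈ Q c) ∧
            (∀ c, ∀ (κ : Fin (d + 1)) (x : Site (PV d ℓ (memF k P n).m (memF k P n).K hd hL) 0), x ∈ Q c → x.shift κ ∈ Q c →
              gaugeY (memF k P n) (g c) (bgY (memF k P n) U₀) κ x = fluct (kGeo (memF k P n)).eta (A c) κ x) ∧
            (∀ c, ∀ κ, ∀ x ∈ Q c, ‖A c κ x‖ ≤ C c * (ξ c)⁻¹) ∧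
            (∀ c, ∀ μ ν, ∀ x ∈ Q c,
              ‖(((kGeo (memF k P n)).eta : ℂ)⁻¹) • covD (shiftsV1 (PV d ℓ (memF k P n).m (memF k P n).K hd hL))
                  (fun _ _ => (1 : (Matrix (Fin N) (Fin N) ℂ)ˣ)) μ (A c ν) x‖ ≤ C c * (ξ c ^ 2)⁻¹) ∧
            (∀ c, max (C c) (C c * (1 + D1 thetaProf)) * Λ c ^ 2 ≤ a₁) ∧ (∀ c, max (C c) (C c * (1 + D1 thetaProf)) * Λ c ^ 2 ≤ 1 / 4)) →
      (∀ m, m ≤ k → ∀ ⦃α₀ : ℝ⦄, 0 < α₀ → α₀ ≤ cL → ∀ U₀ : LSite (d + 1) → Fin (d + 1) → (Matrix (Fin N) (Fin N) ℂ)ˣ,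
          (∀ x κ, U₀ x κ ∈ specialUnitaryUnits (Fin N)) → (∀ (x : LSite (d + 1)) (μ : Fin (d + 1)), U₀ (x + P • e μ) = U₀ x) →
          InAk (ℓ + 1) m η α₀ (fun _ => (Set.univ : Set (LSite (d + 1)))) U₀ →
          B9P3PerAt (𝔸 := Matrix (Fin N) (Fin N) ℂ) (ℓ + 1) B₀ B₀β cB9 βH len η m α₀ P U₀) →
      Thm2SetupSUAt (PV d ℓ m K hd hL) N k η 0 B₁ B₂ c₁ len (fun _ => True) := by
  letI : CStarAlgebra (Matrix (Fin N) (Fin N) ℂ) := {}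
  have hB₁ : 5 * ((d + 1 : ℕ) : ℝ) * ((ℓ + 1 : ℕ) : ℝ) * B₀ * (1 + 11 * (((d + 1 : ℕ) : ℝ)) ^ 2)
      < 5 * ((d + 1 : ℕ) : ℝ) * ((ℓ + 1 : ℕ) : ℝ) * B₀ * (1 + 11 * (((d + 1 : ℕ) : ℝ)) ^ 2) + 1 := lt_add_one _
  have hB₁pos : 0 < 5 * ((d + 1 : ℕ) : ℝ) * ((ℓ + 1 : ℕ) : ℝ) * B₀ * (1 + 11 * (((d + 1 : ℕ) : ℝ)) ^ 2) + 1 := by positivity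
  obtain ⟨a₁, ha₁, a₀', ha₀', M₀, T₀, N₀, H⟩ :=
    thm2TorusAt_specialUnitary_ofCubeData (len := len) (B₀β := B₀β) (βH := βH) hN hd2 hℓ hB₀ hB hcB9 hB₁ b hM₂ hrepr Rr Hp es memF ιBF
  refine ⟨a₁, ha₁, a₀', ha₀', M₀, T₀, N₀, fun cL hcL hαe => ?_⟩
  obtain ⟨B₂, c₁, hB₂, hc₁, HT⟩ := H cL hcL hαe
  refine ⟨_, B₂, c₁, hB₁pos, hB₂, hc₁, fun m K k η P hk hkK hη hP₀ hP hlev hcat hdata hb9 => ?_⟩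
  subst hP₀
  exact thm2SetupSUAt_of_thm2TorusAt
    (HT k _ η hk hη (pow_dvd_period (PV d ℓ m K hd hL) (j := 0) (by simpa using hkK)) hP hlev hcat hdata hb9)

end Setup

end Literature.MathematicalPhysics.QuantumFieldTheory.Balaban1983to89.B8Thm2TorusKnitOfCubeData

end
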